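import Literature.Barriers.CriticalPhenomena.RigorousRGSmallParameterFRDDecompositionSum
import HarnessLib

/-!
# `RigorousRGSmallParameter` (Slade, Theorem 1.4.1): the finite-range decomposition of the
# torus resolvent, `(-Δ_Λ+s)⁻¹ = Σ_{j<N} Γ_j + Γ_{N,N}` (Slade (3.3)–(3.5))

Companion of `RigorousRGSmallParameterFRDDecompositionSum.lean` (`Σ_jΓ_j(s) = (-Δ_{ℤ^d}+s)⁻¹`),
`RigorousRGSmallParameterResolventKernels.lean` ((3.2): the torus resolvent is the periodisation
of the `ℤ^d` resolvent) and `RigorousRGSmallParameterFiniteRange.lean` ((3.3)) in the proof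
architecture of the barrier `RigorousRGSmallParameter.lean`. Source: G. Slade, *Critical
exponents for long-range `O(n)` models below the upper critical dimension*, Commun. Math. Phys.
358 (2018) 343–436, §3.1: "As in (2.18), the torus covariance is (3.2)
`(-Δ_Λ+s)⁻¹_{x,y} = Σ_{z∈ℤ^d} (-Δ_{ℤ^d}+s)⁻¹_{x,y+zL^N}`. By (3.1), `Γ_{j;x,y+L^Nz} = 0` if `j < N`,
`|x-y| < L^N`, and if `z ∈ ℤ^d` is nonzero, and thus (3.3) `Γ_{j;x,y} = Σ_{z∈ℤ^d} Γ_{j;x,y+zL^N}`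
for `j < N`. We can therefore regard `Γ_j` as either a `ℤ^d × ℤ^d` or a `Λ_N × Λ_N` matrix if
`j < N`. We also define (3.4) `Γ_{N,N;x,y} = Σ_{z∈ℤ^d} Σ_{j=N}^∞ Γ_{j;x,y+zL^N}`. It follows that
(3.5) `(-Δ_Λ+s)⁻¹ = Σ_{j=1}^{N-1} Γ_j + Γ_{N,N}`."

## What this file provides

* `FRD.finite_l1Ball`, `FRD.support_Gam_subset`, `FRD.summable_Gam_site`, `FRD.summable_Gam_sub`
  — `Γ_j` has finite support (finite range (3.1)), hence summable rows.
* `FRD.resolventZd_eq_sub_zero`, `FRD.hasSum_Gam_sub` — `Σ_jΓ_j(x-y) = (-Δ+s)⁻¹_{x,y}` as kernels.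
* `FRD.GamTail d L s N c` (**`Σ_{j≥N}Γ_j`**, definition with body), `FRD.hasSum_GamTail`,
  `FRD.resolventZd_eq_sum_add_GamTail` (`(-Δ+s)⁻¹ = Σ_{j<N}Γ_j + Σ_{j≥N}Γ_j` on `ℤ^d`),
  `FRD.summable_GamTail_sub` (rows of the tail kernel are summable: resolvent rows are).
* `FRD.GamNN d L s N M x y` (**`Γ_{N,N}` of (3.4)**: the periodisation of the tail kernel on the
  torus of side `M`; definition with body), `FRD.periodise_finset_sum`.
* **`FRD.Slade2017_display35`** — **(3.5), PROVED**: `(-Δ_Λ+s)⁻¹_{x,y} =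
  Σ_{j=1}^{N-1} (Γ_j)^Λ_{x,y} + Γ_{N,N;x,y}` for every torus side `M ≥ 1`, `N ≥ 1`, `L > 1`,
  `s > 0` (here `(Γ_j)^Λ` is the periodisation of `Γ_j`; no relation between `M` and `L^N` is
  needed for the identity).
* **`FRD.Slade2017_display33_Gam`** — **(3.3), PROVED**: for `L^j ≤ 2R ≤ M`, the periodisation
  of `Γ_j` at torus points with representatives at `ℓ¹`-distance `< R` is `Γ_j` itself ("we can
  regard `Γ_j` as either a `ℤ^d × ℤ^d` or a `Λ_N × Λ_N` matrix if `j < N`").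

No named fact is introduced. Not treated here: the covariance `C_{N,N}` and (3.7) on the torus,
the estimate (3.10).
-/

noncomputable section

namespace Literature.Barriers.CriticalPhenomena

open _root_.MeasureTheory Set Filter
open scoped _root_.Topology Real

namespace LongRangePhi4

namespace FRD

open Literature.Probability.LatticeModels

variable {d : ℕ}

/-! ### Finite support of `Γ_j` -/

/-- `ℓ¹`-balls of `ℤ^d` are finite. [folklore] -/
theorem finite_l1Ball (R : ℝ) : {c : Site d | (((∑ i, (c i).natAbs : ℕ) : ℝ)) < R}.Finite := by
  obtain ⟨n, hn⟩ := exists_nat_ge R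
  refine (Set.Finite.pi fun _ : Fin d => Set.finite_Icc (-(n : ℤ)) n).subset fun c hc => ?_
  refine Set.mem_univ_pi.2 fun i => ?_
  have hc' : (((∑ k, (c k).natAbs : ℕ) : ℝ)) < R := hc
  have h1 : (c i).natAbs ≤ ∑ k, (c k).natAbs :=
    Finset.single_le_sum (f := fun k => (c k).natAbs) (fun k _ => Nat.zero_le _) (Finset.mem_univ i)
  have h2 : ((∑ k, (c k).natAbs : ℕ) : ℝ) < n := lt_of_lt_of_le hc' hn
  have h3 : (∑ k, (c k).natAbs) < n := by exact_mod_cast h2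
  have h4 : (c i).natAbs < n := lt_of_le_of_lt h1 h3
  constructor <;> omega

/-- The support of `Γ_j` lies in the `ℓ¹`-ball of radius `½L^j` (finite range (3.1)).
[cite: Slade2017, §3.1 (display (3.1))] -/
theorem support_Gam_subset (hd : 1 ≤ d) {L : ℝ} (hL : 0 ≤ L) {s : ℝ} (hs : 0 ≤ s) (j : ℕ) :
    (Function.support fun c : Site d => Gam d L s j c) ⊆
      {c | (((∑ i, (c i).natAbs : ℕ) : ℝ)) < L ^ j / 2} := by
  intro c hc
  by_contra h
  exact hc (Gam_eq_zero hd hL hs j c (not_lt.1 h))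

/-- `Γ_j(·)(s)` is summable over `ℤ^d` (finite support). [folklore] -/
theorem summable_Gam_site (hd : 1 ≤ d) {L : ℝ} (hL : 0 ≤ L) {s : ℝ} (hs : 0 ≤ s) (j : ℕ) :
    Summable fun c : Site d => Gam d L s j c :=
  summable_of_hasFiniteSupport ((finite_l1Ball _).subset (support_Gam_subset hd hL hs j))

/-- The rows `y ↦ Γ_j(x-y)` of the kernel `Γ_{j;x,y} = Γ_j(x-y)` are summable. [folklore] -/
theorem summable_Gam_sub (hd : 1 ≤ d) {L : ℝ} (hL : 0 ≤ L) {s : ℝ} (hs : 0 ≤ s) (j : ℕ)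
    (a : Site d) : Summable fun b : Site d => Gam d L s j (a - b) :=
  (summable_Gam_site hd hL hs j).comp_injective sub_right_injective

/-! ### The resolvent kernel as `Σ_j Γ_j` -/

/-- `(-Δ+s)⁻¹_{x,y} = (-Δ+s)⁻¹_{x-y,0}` (translation invariance, definitionally through
`cos(k·(x-y))`). [cite: Slade2017, §2.1.2 (display (2.12))] -/
theorem resolventZd_eq_sub_zero (s : ℝ) (a b : Site d) :
    resolventZd d s a b = resolventZd d s (a - b) 0 := by
  unfold resolventZd
  congr 1
  refine integral_congr_ae (Eventually.of_forall fun k => ?_)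
  simp only [Pi.sub_apply, Int.cast_sub, Pi.zero_apply, Int.cast_zero, sub_zero]

/-- `Σ_{j≥1} Γ_j(x-y)(s) = (-Δ+s)⁻¹_{x,y}` (entrywise, indexed by `m = j-1`).
[cite: Slade2017, §3.1 (first display)] -/
theorem hasSum_Gam_sub {L : ℝ} (hL : 1 < L) {s : ℝ} (hs : 0 < s) (a b : Site d) :
    HasSum (fun m : ℕ => Gam d L s (m + 1) (a - b)) (resolventZd d s a b) := by
  rw [resolventZd_eq_sub_zero]
  exact hasSum_Gam hL hs (a - b)

/-! ### The tail `Σ_{j≥N} Γ_j` and `Γ_{N,N}` -/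

/-- **The tail of the decomposition, `Σ_{j≥N} Γ_j(c)(s)`** (indexed by `m = j - N`).
[cite: Slade2017, §3.1 (display (3.4), inner sum)] -/
def GamTail (d : ℕ) (L s : ℝ) (N : ℕ) (c : Site d) : ℝ := ∑' m : ℕ, Gam d L s (m + N) c

/-- **`Γ_{N,N}` (Slade (3.4))**: `Γ_{N,N;x,y} = Σ_{z∈ℤ^d} Σ_{j≥N} Γ_{j;x̃,ỹ+Mz}`, the periodisation
of the tail kernel on the torus `(ℤ/Mℤ)^d` (Slade takes `M = L^N`).
[cite: Slade2017, §3.1 (display (3.4))] -/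
def GamNN (d : ℕ) (L s : ℝ) (N M : ℕ) (x y : TorusSite d M) : ℝ :=
  periodise M (fun a b => GamTail d L s N (a - b)) x y

/-- The tail series converges. [folklore] -/
theorem hasSum_GamTail {L : ℝ} (hL : 1 < L) {s : ℝ} (hs : 0 < s) (N : ℕ) (c : Site d) :
    HasSum (fun m : ℕ => Gam d L s (m + N) c) (GamTail d L s N c) := by
  have h1 : Summable fun j : ℕ => Gam d L s j c :=
    (summable_nat_add_iff 1).1 (hasSum_Gam hL hs c).summable
  unfold GamTail
  exact ((summable_nat_add_iff N).2 h1).hasSum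

/-- **`(-Δ+s)⁻¹_{x,y} = Σ_{j=1}^{N-1} Γ_j(x-y) + Σ_{j≥N} Γ_j(x-y)`** on `ℤ^d` (`N ≥ 1`).
[cite: Slade2017, §3.1 (first display, split at j = N)] -/
theorem resolventZd_eq_sum_add_GamTail {L : ℝ} (hL : 1 < L) {s : ℝ} (hs : 0 < s) {N : ℕ}
    (hN : 1 ≤ N) (a b : Site d) :
    resolventZd d s a b =
      (∑ m ∈ Finset.range (N - 1), Gam d L s (m + 1) (a - b)) + GamTail d L s N (a - b) := by
  have h := hasSum_Gam_sub hL hs a b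
  rw [← h.tsum_eq, ← h.summable.sum_add_tsum_nat_add (N - 1)]
  congr 1
  unfold GamTail
  refine tsum_congr fun m => ?_
  congr 1
  omega

/-- The rows of the tail kernel `y ↦ Σ_{j≥N}Γ_j(x-y)` are summable (resolvent rows are, and
the finitely many `Γ_j`, `j < N`, have finite support). [folklore] -/
theorem summable_GamTail_sub (hd : 1 ≤ d) {L : ℝ} (hL : 1 < L) {s : ℝ} (hs : 0 < s) {N : ℕ}
    (hN : 1 ≤ N) (a : Site d) : Summable fun b : Site d => GamTail d L s N (a - b) := by
  have h1 : Summable fun b => resolventZd d s a b := (hasSum_resolventZd_row hd hs a).summable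
  have h2 : Summable fun b => ∑ m ∈ Finset.range (N - 1), Gam d L s (m + 1) (a - b) :=
    summable_sum fun m _ => summable_Gam_sub hd (zero_le_one.trans hL.le) hs.le (m + 1) a
  have he : (fun b => GamTail d L s N (a - b)) =
      fun b => resolventZd d s a b - ∑ m ∈ Finset.range (N - 1), Gam d L s (m + 1) (a - b) := by
    funext b
    rw [resolventZd_eq_sum_add_GamTail hL hs hN a b]
    ring
  rw [he]
  exact h1.sub h2

/-! ### Periodisation of finite sums -/

/-- Periodisation commutes with finite sums (rows summable). [folklore] -/
theorem periodise_finset_sum {M : ℕ} [NeZero M] {ι : Type*} (S : Finset ι)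
    (K : ι → Site d → Site d → ℝ) (x y : TorusSite d M)
    (h : ∀ i ∈ S, Summable fun w => K i (fun j => ((x j).val : ℤ)) w) :
    periodise M (fun a b => ∑ i ∈ S, K i a b) x y = ∑ i ∈ S, periodise M (K i) x y := by
  classical
  induction S using Finset.induction_on with
  | empty => simp [periodise]
  | insert i S hi ih =>
      have h' : ∀ k ∈ S, Summable fun w => K k (fun j => ((x j).val : ℤ)) w :=
        fun k hk => h k (Finset.mem_insert_of_mem hk)
      have hfun : (fun a b => ∑ k ∈ insert i S, K k a b) = fun a b => K i a b + ∑ k ∈ S, K k a b := by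
        funext a b
        rw [Finset.sum_insert hi]
      rw [hfun, Finset.sum_insert hi, periodise_add (K i) (fun a b => ∑ k ∈ S, K k a b) x y
        (h i (Finset.mem_insert_self i S)) (summable_sum fun k hk => h' k hk), ih h']

/-! ### (3.5) and (3.3) -/

/-- **Slade, display (3.5), PROVED: `(-Δ_Λ+s)⁻¹ = Σ_{j=1}^{N-1} Γ_j + Γ_{N,N}`** on the torus
`Λ = (ℤ/Mℤ)^d`: for `d ≥ 1`, `M ≥ 1`, `L > 1`, `s > 0`, `N ≥ 1` and all `x, y ∈ Λ`,
`(-Δ_Λ+s)⁻¹_{x,y} = Σ_{j=1}^{N-1} (Γ_j)^Λ_{x,y} + Γ_{N,N;x,y}`, where `(Γ_j)^Λ` is the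
periodisation of the kernel `Γ_{j;x,y} = Γ_j(x-y)` and `Γ_{N,N}` is (3.4) — from (3.2)
(`Slade2017_torusLaplaceResolvent`), `Σ_jΓ_j = (-Δ+s)⁻¹` and the additivity of periodisation.
(The identity holds for any torus side `M`; Slade's `M = L^N` matters only for (3.3).)
[cite: Slade2017, §3.1 (display (3.5))] -/
theorem Slade2017_display35 (hd : 1 ≤ d) {M : ℕ} [NeZero M] {L : ℝ} (hL : 1 < L) {s : ℝ}
    (hs : 0 < s) {N : ℕ} (hN : 1 ≤ N) (x y : TorusSite d M) :
    (covInvMatrix d 1 M s)⁻¹ x y =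
      (∑ m ∈ Finset.range (N - 1), periodise M (fun a b => Gam d L s (m + 1) (a - b)) x y) +
        GamNN d L s N M x y := by
  rw [Slade2017_torusLaplaceResolvent hd hs, Matrix.of_apply]
  have hker : resolventZd d s = fun a b =>
      (∑ m ∈ Finset.range (N - 1), Gam d L s (m + 1) (a - b)) + GamTail d L s N (a - b) := by
    funext a b
    exact resolventZd_eq_sum_add_GamTail hL hs hN a b
  have hL0 : (0 : ℝ) ≤ L := zero_le_one.trans hL.le
  rw [hker, periodise_add (fun a b => ∑ m ∈ Finset.range (N - 1), Gam d L s (m + 1) (a - b))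
    (fun a b => GamTail d L s N (a - b)) x y
    (summable_sum fun m _ => summable_Gam_sub hd hL0 hs.le (m + 1) _)
    (summable_GamTail_sub hd hL hs hN _),
    periodise_finset_sum (Finset.range (N - 1)) (fun m a b => Gam d L s (m + 1) (a - b)) x y
      fun m _ => summable_Gam_sub hd hL0 hs.le (m + 1) _]
  rfl

/-- **Slade, display (3.3), PROVED for `Γ_j`**: if `½L^j ≤ R` and `2R ≤ M`, then for
representatives `a, b ∈ ℤ^d` at `ℓ¹`-distance `< R` the periodisation of `Γ_j` on `(ℤ/Mℤ)^d` is
`Γ_j(a-b)` itself — "By (3.1), `Γ_{j;x,y+L^Nz} = 0` if `j < N`, `|x-y| < L^N`, and if `z` is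
nonzero, and thus `Γ_{j;x,y} = Σ_z Γ_{j;x,y+zL^N}` for `j < N`. We can therefore regard `Γ_j` as
either a `ℤ^d × ℤ^d` or a `Λ_N × Λ_N` matrix" (for `M = L^N`, `j < N`, `L ≥ 2` one may take
`R = ⌈½L^j⌉`). [cite: Slade2017, §3.1 (display (3.3))] -/
theorem Slade2017_display33_Gam (hd : 1 ≤ d) {M : ℕ} [NeZero M] {L : ℝ} (hL : 0 ≤ L) {s : ℝ}
    (hs : 0 ≤ s) (j : ℕ) {R : ℕ} (hR : L ^ j / 2 ≤ R) (hM : 2 * R ≤ M) (a b : Site d)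
    (hab : (∑ i, ((a - b) i).natAbs) < R) :
    periodise M (fun a b => Gam d L s j (a - b)) (fun i => (a i : ZMod M)) (fun i => (b i : ZMod M)) =
      Gam d L s j (a - b) :=
  Slade2017_display33 (K := fun a b => Gam d L s j (a - b))
    (fun a b v => by simp only [add_sub_add_right_eq_sub])
    (fun a' b' h => Gam_eq_zero hd hL hs j (a' - b') (hR.trans (by exact_mod_cast h))) hM a b hab

end FRD

end LongRangePhi4

end Literature.Barriers.CriticalPhenomena
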